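import Literature.NumberTheory.EllipticCurves.TowerSaturatedCartesianPresentedProofs
import Literature.NumberTheory.EllipticCurves.IwasawaTwistModPkTower
import Literature.NumberTheory.GaloisRepresentations.ContinuousCohomologyConnectingNaturality
import HarnessLib

/-!
# Liftability (L) and exactness (E) for the tower of `H¹`'s of an exact tower of finite discrete
# Galois modules — the cohomological inputs of Howard's H.3 for saturated conditions (theorems only)

`Proofs` file (theorems only; no definition, no named fact, no instance, no `sorry`).  Companion of
`TowerSaturatedCartesianProofs` (`Tower.comap_levelCondition_eq_of_liftable`, x10b-p2 LEAD g5), its `π`-adic /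
scalar form `TowerSaturatedCartesianScalarProofs` (x10b-p1-w6) and `TowerSaturatedCartesianPresentedProofs`
(Kőnig in constraint form).  Those files prove that the SATURATED level conditions of a tower
`H_j = H¹(F, W_j)` are CARTESIAN (Howard 2004, H.3, for the Selmer structure `F_𝔮` propagated from `V_𝔮`;
arXiv:1202.6340 p. 16 L1–3, Mazur–Rubin Lemma 3.7.1) from two cohomological hypotheses on the tower, which
this file DISCHARGES for every tower of finite discrete `Γ_F`-modules presented as follows (D1's memo
`HOME/p1/H3-CARTESIAN-PLAN`, steps (L) and (E)):

**Presentation.** `W : ℕ → Type`, `ρ j` a discrete `Γ_F`-module structure on `W j`, and ONE two-index family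
of continuous equivariant maps `f a b : W a → W b` — for `b ≤ a` the REDUCTIONS `T/π^a ↠ T/π^b`, for
`a ≤ b` the injective `Quot(T)`-morphisms `×π^{b-a} : T/π^a ↪ T/π^b` (Howard Def. 1.1.3) — subject to the
four element-level identities

* `f a a = id`;  `f b c ∘ f a b = f a c` for `c ≤ b ≤ a` (reductions compose);
* `f a b ∘ f (a+1) a = f (b+1) b ∘ f (a+1) (b+1)` for `a ≤ b` (`×π^d` commutes with reduction);
* `0 → W ℓ →(f ℓ (ℓ+n)) W (ℓ+n) →(f (ℓ+n) n) W n → 0` is exact for all `ℓ`, `n`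
  (`×π^n` is injective with image the kernel of the reduction `T/π^{ℓ+n} ↠ T/π^n`),

and finiteness of the `H¹(F, W j)` (local fields: Serre II §5); a single two-index family makes every naturality
square typecheck with free indices.  The tower is `red j := H¹(f (j+1) j)`, `lim_j H¹(F, W_j) = compatibleFamilies red`.

**Results** (`F` any field; `H¹` = the tree's `galoisCohomology _ 1`):
* §1 functoriality bookkeeping: `H¹(f a b)` of a compatible family is its `b`-component (`map_apply_eq_of_mem`),
  `Tower.redIter = H¹(f (i+d) i)`, the multi-step mixed square, `H¹` of the composite `W ℓ → W (ℓ+n) → W n`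
  vanishes; the short exact sequences as the tree's `IsSES`.
* §2 **(E) EXACTNESS** `exists_forall_map_eq_of_apply_eq_zero`: a compatible family `x` with `x n = 0` is
  `x (ℓ+n) = H¹(f ℓ (ℓ+n)) (h ℓ)` for a compatible `h` — `ker (H¹(T) → H¹(T/π^n)) = π^n H¹(T)` in the limit
  (middle exactness of `H¹` level by level + Kőnig); endomorphism / scalar forms
  `exists_forall_map_endo_eq_of_apply_eq_zero`, `exists_forall_scalarMapH1_eq_of_apply_eq_zero`
  (`x j = H¹(s•) (h j)` for a scalar `s` acting as `f ℓ (ℓ+n) ∘ f (ℓ+n) ℓ` on `W (ℓ+n)` and as `0` below `n`)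
  — the hypothesis `hE` of `comap_levelCondition_eq_of_liftable[_smul]` after `galoisCohomology.smul_def`.
* §3 **(L) LIFTABILITY** `exists_mem_compatibleFamilies_apply_eq_of_map_eq`: if `H¹(f i (i+d)) y` is the
  `(i+d)`-component of a compatible family then `y` is the `i`-component of a compatible family — VERBATIM the
  hypothesis `hL` (with `mul := H¹(f i (i+d))`): exactness at `H¹(W i)` (`δ₀`), NATURALITY of `δ₀` along the
  morphism of short exact sequences `(f j i, f (j+d) (i+d), id)` (tree `IsSES.cohomologyMap_δ₀`), Kőnig.
* §4 (M) `H¹(f i (i+d)) ∘ redIter = H¹(s•)` from `f i (i+d) ∘ f (i+d) i = s•`, and (T) `H¹(s•) = 0` from `s• = 0`.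

Cell `pub/bsd-print-x9`, shared μ-item of rows 9/10, skeleton v9 STUB 1b (H.3); seat `bsd-line-x10b-p1-w7` g0
(claim (e′)).  No summit statement is proved; BSD is not proved by any of this.

References: B. Howard, Compositio Math. 140 (2004), Def. 1.1.3, H.3, §1.6, Lemma 3.2.7 (arXiv:1202.6340 p. 5,
p. 12, p. 16); Mazur–Rubin (2004), Lemma 3.7.1; Serre, *Galois Cohomology* (1997), I §2.2; NSW (2008), (1.3.3), 2.7.6.
-/

noncomputable section

open CategoryTheory
open scoped ContRepresentation
universe u

namespace Literature.NumberTheory.EllipticCurves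

namespace Tower

open Literature.NumberTheory.GaloisRepresentations

variable {F : Type u} [Field F]
variable {W : ℕ → Type u} [∀ j, AddCommGroup (W j)] [∀ j, TopologicalSpace (W j)]
  [∀ j, DiscreteTopology (W j)]
variable (ρ : ∀ j, DiscreteGaloisModule F (W j))
variable (f : ∀ a b, (ρ a).toContRepresentation →ⁱL (ρ b).toContRepresentation)

/-! ## §1 Functoriality bookkeeping for a two-index presentation -/

/-- `H¹` of a map that is the identity on elements is the identity. [cite: SerreGaloisCohomology1997, Ch. I §2.2] -/
theorem map_apply_eq_self_of_forall_apply_eq {M : Type u} [AddCommGroup M] [TopologicalSpace M]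
    [DiscreteTopology M] {τ : DiscreteGaloisModule F M}
    (g : τ.toContRepresentation →ⁱL τ.toContRepresentation) (hg : ∀ w, g w = w)
    (c : galoisCohomology τ 1) : galoisCohomology.map g 1 c = c := by
  obtain ⟨φ, rfl⟩ := oneCocycleClass_surjective _ c
  rw [galoisCohomology.map_oneCocycleClass_ofHom]
  congr 1
  exact Subtype.ext (ContinuousMap.ext fun σ => hg _)

/-- **A downward map of the presentation evaluates compatible families**: for `b ≤ a` and a family `x`
compatible under the one-step reductions `H¹(f (j+1) j)`, `H¹(f a b) (x a) = x b` (reductions compose).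
[cite: SerreGaloisCohomology1997, Ch. I §2.2 (inverse limits)] [cite: Howard2004HeegnerKolyvagin, §1.6 (arXiv p. 12, L29–55)] -/
theorem map_apply_eq_of_mem (hid : ∀ a (w : W a), f a a w = w)
    (hcomp : ∀ a b c, c ≤ b → b ≤ a → ∀ w : W a, f b c (f a b w) = f a c w)
    {x : Π j, galoisCohomology (ρ j) 1}
    (hx : x ∈ compatibleFamilies (H := fun j ↦ galoisCohomology (ρ j) 1)
      (fun j ↦ galoisCohomology.map (f (j + 1) j) 1))
    {a b : ℕ} (hab : b ≤ a) : galoisCohomology.map (f a b) 1 (x a) = x b := by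
  obtain ⟨e, rfl⟩ := Nat.exists_eq_add_of_le hab
  induction e with
  | zero => exact map_apply_eq_self_of_forall_apply_eq (f b b) (hid b) (x b)
  | succ e ih =>
    have hxc := (mem_compatibleFamilies_iff _ x).mp hx (b + e)
    change galoisCohomology.map (f (b + e + 1) b) 1 (x (b + e + 1)) = x b
    rw [← galoisCohomology.map_map_of_comp_apply (f (b + e + 1) (b + e)) (f (b + e) b) (f (b + e + 1) b)
      (fun w ↦ (hcomp _ _ _ (Nat.le_add_right b e) (Nat.le_succ _) w).symm)]
    rw [hxc]
    exact ih (Nat.le_add_right b e)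

/-- **The iterated reduction `Tower.redIter` of the `H¹`-tower is `H¹(f (i+d) i)`.**
[cite: Howard2004HeegnerKolyvagin, Def. 1.1.3 (arXiv p. 5: the morphisms of Quot(T))] -/
theorem redIter_eq_map (hid : ∀ a (w : W a), f a a w = w)
    (hcomp : ∀ a b c, c ≤ b → b ≤ a → ∀ w : W a, f b c (f a b w) = f a c w) (i d : ℕ)
    (y : galoisCohomology (ρ (i + d)) 1) :
    redIter (H := fun j ↦ galoisCohomology (ρ j) 1) (fun j ↦ galoisCohomology.map (f (j + 1) j) 1) i d y =
      galoisCohomology.map (f (i + d) i) 1 y := by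
  induction d with
  | zero => exact (map_apply_eq_self_of_forall_apply_eq (f i i) (hid i) y).symm
  | succ d ih =>
    change redIter (H := fun j ↦ galoisCohomology (ρ j) 1) (fun j ↦ galoisCohomology.map (f (j + 1) j) 1) i d
        (galoisCohomology.map (f (i + d + 1) (i + d)) 1 y) = galoisCohomology.map (f (i + d + 1) i) 1 y
    rw [ih, galoisCohomology.map_map_of_comp_apply (f (i + d + 1) (i + d)) (f (i + d) i) (f (i + d + 1) i)
      (fun w ↦ (hcomp _ _ _ (Nat.le_add_right i d) (Nat.le_succ _) w).symm)]

/-- **The multi-step mixed square**: `f (j+d) (i+d) ∘ f j (j+d) = f i (i+d) ∘ f j i` on elements for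
`i ≤ j` (`×π^d` commutes with the reduction `T/π^j ↠ T/π^i`), from the one-step square by induction.
[cite: Howard2004HeegnerKolyvagin, Def. 1.1.3 (arXiv p. 5, L95–97)] -/
theorem apply_up_down_comm (hid : ∀ a (w : W a), f a a w = w)
    (hcomp : ∀ a b c, c ≤ b → b ≤ a → ∀ w : W a, f b c (f a b w) = f a c w)
    (hsq : ∀ a b, a ≤ b → ∀ w : W (a + 1), f a b (f (a + 1) a w) = f (b + 1) b (f (a + 1) (b + 1) w))
    {i j : ℕ} (hij : i ≤ j) (d : ℕ) (w : W j) :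
    f (j + d) (i + d) (f j (j + d) w) = f i (i + d) (f j i w) := by
  obtain ⟨e, rfl⟩ := Nat.exists_eq_add_of_le hij
  induction e with
  | zero =>
    change f (i + d) (i + d) (f i (i + d) w) = f i (i + d) (f i i w)
    rw [hid, hid]
  | succ e ih =>
    change f (i + e + 1 + d) (i + d) (f (i + e + 1) (i + e + 1 + d) w) = f i (i + d) (f (i + e + 1) i w)
    have h1 : f (i + e + 1 + d) (i + d) (f (i + e + 1) (i + e + 1 + d) w) =
        f (i + e + d) (i + d) (f (i + e + d + 1) (i + e + d) (f (i + e + 1) (i + e + d + 1) w)) := by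
      rw [Nat.add_right_comm (i + e) 1 d, hcomp _ _ _ (Nat.add_le_add_right (Nat.le_add_right i e) d)
        (Nat.le_succ _)]
    rw [h1, ← hsq _ _ (Nat.le_add_right (i + e) d), ih (Nat.le_add_right i e) (f (i + e + 1) (i + e) w),
      hcomp _ _ _ (Nat.le_add_right i e) (Nat.le_succ _)]

/-- `H¹` of the composite `W ℓ → W (ℓ+n) → W n` of an exact presentation vanishes.
[cite: SerreGaloisCohomology1997, Ch. I §2.2 (cohomology exact sequence)] -/
theorem map_map_eq_zero_of_exact
    (hex : ∀ ℓ n (y : W (ℓ + n)), f (ℓ + n) n y = 0 ↔ ∃ x, f ℓ (ℓ + n) x = y) (ℓ n : ℕ)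
    (c : galoisCohomology (ρ ℓ) 1) :
    galoisCohomology.map (f (ℓ + n) n) 1 (galoisCohomology.map (f ℓ (ℓ + n)) 1 c) = 0 := by
  rw [galoisCohomology.map_map_of_comp_apply (f ℓ (ℓ + n)) (f (ℓ + n) n)
    ((f (ℓ + n) n).comp (f ℓ (ℓ + n))) (fun _ ↦ rfl)]
  exact galoisCohomology.map_eq_zero_of_apply_eq_zero ((f (ℓ + n) n).comp (f ℓ (ℓ + n)))
    (fun w ↦ (hex ℓ n _).mpr ⟨w, rfl⟩) c

/-- **The levels form short exact sequences of discrete `Γ_F`-modules** (tree `IsSES`) —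
`0 → W ℓ → W (ℓ+n) → W n → 0`. [cite: Howard2004HeegnerKolyvagin, §1.6 (arXiv p. 12: the exact 𝔪-adic tower)]
[cite: SerreGaloisCohomology1997, Ch. I §2.2] -/
theorem isSES_of_exact (hinj : ∀ ℓ n, Function.Injective (f ℓ (ℓ + n)))
    (hsurj : ∀ ℓ n, Function.Surjective (f (ℓ + n) n))
    (hex : ∀ ℓ n (y : W (ℓ + n)), f (ℓ + n) n y = 0 ↔ ∃ x, f ℓ (ℓ + n) x = y) (ℓ n : ℕ) :
    IsSES (TopRep.ofHom ⟨(f ℓ (ℓ + n)).toContinuousLinearMap, (f ℓ (ℓ + n)).isIntertwining'⟩ :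
        (ρ ℓ).toTopRep ⟶ (ρ (ℓ + n)).toTopRep)
      (TopRep.ofHom ⟨(f (ℓ + n) n).toContinuousLinearMap, (f (ℓ + n) n).isIntertwining'⟩ :
        (ρ (ℓ + n)).toTopRep ⟶ (ρ n).toTopRep) where
  comp_eq_zero := by
    ext x
    exact (hex ℓ n _).mpr ⟨x, rfl⟩
  injective := hinj ℓ n
  exact_mid y hy := (hex ℓ n y).mp hy
  surjective := hsurj ℓ n

/-! ## §2 (E) Exactness in the limit: `ker (H¹(T) → H¹(T/π^n)) = π^n · H¹(T)` -/

/-- **(E) EXACTNESS, map form.** For a compatible family `x` of `lim_j H¹(F, W_j)` with `x n = 0` there is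
a compatible family `h` with `H¹(f ℓ (ℓ+n)) (h ℓ) = x (ℓ+n)` for every `ℓ`: level by level `x (ℓ+n)` dies
in `H¹(W n)` (it reduces to `x n = 0`), so comes from `H¹(W ℓ)` by exactness of `H¹` in the middle; the
sets of such preimages are finite, nonempty and reduction-stable, so Kőnig gives a compatible choice.
[cite: Howard2004HeegnerKolyvagin, §1.6 and Lemma 3.2.7 (arXiv p. 12 L29–55, p. 16 L142–148)]
[cite: SerreGaloisCohomology1997, Ch. I §2.2] -/
theorem exists_forall_map_eq_of_apply_eq_zero [∀ j, Finite (galoisCohomology (ρ j) 1)]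
    (hid : ∀ a (w : W a), f a a w = w)
    (hcomp : ∀ a b c, c ≤ b → b ≤ a → ∀ w : W a, f b c (f a b w) = f a c w)
    (hsq : ∀ a b, a ≤ b → ∀ w : W (a + 1), f a b (f (a + 1) a w) = f (b + 1) b (f (a + 1) (b + 1) w))
    (hinj : ∀ ℓ n, Function.Injective (f ℓ (ℓ + n)))
    (hsurj : ∀ ℓ n, Function.Surjective (f (ℓ + n) n))
    (hex : ∀ ℓ n (y : W (ℓ + n)), f (ℓ + n) n y = 0 ↔ ∃ x, f ℓ (ℓ + n) x = y)
    (n : ℕ) {x : Π j, galoisCohomology (ρ j) 1}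
    (hx : x ∈ compatibleFamilies (H := fun j ↦ galoisCohomology (ρ j) 1)
      (fun j ↦ galoisCohomology.map (f (j + 1) j) 1))
    (hxn : x n = 0) :
    ∃ h ∈ compatibleFamilies (H := fun j ↦ galoisCohomology (ρ j) 1)
        (fun j ↦ galoisCohomology.map (f (j + 1) j) 1),
      ∀ ℓ, galoisCohomology.map (f ℓ (ℓ + n)) 1 (h ℓ) = x (ℓ + n) := by
  refine exists_mem_compatibleFamilies_of_forall_mem (H := fun j ↦ galoisCohomology (ρ j) 1)
    (fun j ↦ galoisCohomology.map (f (j + 1) j) 1)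
    (fun ℓ ↦ {w | galoisCohomology.map (f ℓ (ℓ + n)) 1 w = x (ℓ + n)}) (fun ℓ ↦ ?_) (fun ℓ w hw ↦ ?_)
  · -- nonempty: middle exactness at `H¹(W (ℓ+n))`
    have hzero : galoisCohomology.map (f (ℓ + n) n) 1 (x (ℓ + n)) = 0 := by
      rw [map_apply_eq_of_mem ρ f hid hcomp hx (Nat.le_add_left n ℓ), hxn]
    have hzero' : cohomologyMap (TopRep.ofHom ⟨(f (ℓ + n) n).toContinuousLinearMap,
        (f (ℓ + n) n).isIntertwining'⟩ : (ρ (ℓ + n)).toTopRep ⟶ (ρ n).toTopRep) 1 (x (ℓ + n)) = 0 := by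
      rw [← galoisCohomology.map_eq_cohomologyMap_apply]; exact hzero
    obtain ⟨w, hw⟩ :=
      (isSES_of_exact ρ f hinj hsurj hex ℓ n).exists_map_one_eq_of_map_one_eq_zero (x (ℓ + n)) hzero'
    refine ⟨w, ?_⟩
    change galoisCohomology.map (f ℓ (ℓ + n)) 1 w = x (ℓ + n)
    rw [galoisCohomology.map_eq_cohomologyMap_apply]
    exact hw
  · -- reduction-stable: `×π^n` commutes with the reductions
    change galoisCohomology.map (f (ℓ + 1) (ℓ + 1 + n)) 1 w = x (ℓ + 1 + n) at hw
    change galoisCohomology.map (f ℓ (ℓ + n)) 1 (galoisCohomology.map (f (ℓ + 1) ℓ) 1 w) = x (ℓ + n)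
    rw [Nat.add_right_comm ℓ 1 n] at hw
    rw [galoisCohomology.map_map_of_comp_apply (f (ℓ + 1) ℓ) (f ℓ (ℓ + n))
      ((f ℓ (ℓ + n)).comp (f (ℓ + 1) ℓ)) (fun _ ↦ rfl)]
    have hxc := (mem_compatibleFamilies_iff _ x).mp hx (ℓ + n)
    change galoisCohomology.map (f (ℓ + n + 1) (ℓ + n)) 1 (x (ℓ + n + 1)) = x (ℓ + n) at hxc
    rw [← hxc, ← hw, galoisCohomology.map_map_of_comp_apply (f (ℓ + 1) (ℓ + n + 1)) (f (ℓ + n + 1) (ℓ + n))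
      ((f ℓ (ℓ + n)).comp (f (ℓ + 1) ℓ)) (fun v ↦ hsq ℓ (ℓ + n) (Nat.le_add_right ℓ n) v)]

/-- **(E) EXACTNESS, endomorphism form.** If equivariant endomorphisms `s j` of the levels act as
`f ℓ (ℓ+n) ∘ f (ℓ+n) ℓ` on `W (ℓ+n)` (the scalar `π^n`: reduce, then `×π^n`) and as `0` on `W j` for `j < n`,
then a compatible family `x` with `x n = 0` is `x j = H¹(s j) (h j)` for a compatible `h` — the hypothesis `hE`
of `Tower.comap_levelCondition_eq_of_liftable[_smul]` (`x = π^n • h`).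
[cite: Howard2004HeegnerKolyvagin, §1.6 and Lemma 3.2.7 (arXiv p. 12, p. 16)] [cite: SerreGaloisCohomology1997, Ch. I §2.2] -/
theorem exists_forall_map_endo_eq_of_apply_eq_zero [∀ j, Finite (galoisCohomology (ρ j) 1)]
    (hid : ∀ a (w : W a), f a a w = w)
    (hcomp : ∀ a b c, c ≤ b → b ≤ a → ∀ w : W a, f b c (f a b w) = f a c w)
    (hsq : ∀ a b, a ≤ b → ∀ w : W (a + 1), f a b (f (a + 1) a w) = f (b + 1) b (f (a + 1) (b + 1) w))
    (hinj : ∀ ℓ n, Function.Injective (f ℓ (ℓ + n)))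
    (hsurj : ∀ ℓ n, Function.Surjective (f (ℓ + n) n))
    (hex : ∀ ℓ n (y : W (ℓ + n)), f (ℓ + n) n y = 0 ↔ ∃ x, f ℓ (ℓ + n) x = y)
    (n : ℕ) (s : ∀ j, (ρ j).toContRepresentation →ⁱL (ρ j).toContRepresentation)
    (hs : ∀ ℓ (w : W (ℓ + n)), s (ℓ + n) w = f ℓ (ℓ + n) (f (ℓ + n) ℓ w))
    (hs0 : ∀ j, j < n → ∀ w : W j, s j w = 0)
    {x : Π j, galoisCohomology (ρ j) 1}
    (hx : x ∈ compatibleFamilies (H := fun j ↦ galoisCohomology (ρ j) 1)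
      (fun j ↦ galoisCohomology.map (f (j + 1) j) 1))
    (hxn : x n = 0) :
    ∃ h ∈ compatibleFamilies (H := fun j ↦ galoisCohomology (ρ j) 1)
        (fun j ↦ galoisCohomology.map (f (j + 1) j) 1),
      ∀ j, galoisCohomology.map (s j) 1 (h j) = x j := by
  obtain ⟨h, hh, hhx⟩ := exists_forall_map_eq_of_apply_eq_zero ρ f hid hcomp hsq hinj hsurj hex n hx hxn
  refine ⟨h, hh, fun j ↦ ?_⟩
  by_cases hj : j < n
  · rw [galoisCohomology.map_eq_zero_of_apply_eq_zero (s j) (hs0 j hj),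
      apply_eq_zero_of_apply_eq_zero_of_le (H := fun j ↦ galoisCohomology (ρ j) 1) _ hx hxn hj.le]
  · obtain ⟨ℓ, rfl⟩ := Nat.exists_eq_add_of_le' (not_lt.mp hj)
    rw [← hhx ℓ, ← map_apply_eq_of_mem ρ f hid hcomp hh (Nat.le_add_right ℓ n),
      galoisCohomology.map_map_of_comp_apply (f (ℓ + n) ℓ) (f ℓ (ℓ + n)) (s (ℓ + n)) (hs ℓ)]

/-- **(E) EXACTNESS, scalar form.** For `R`-linear levels (`IsScalarLinear`) and a scalar `r` acting as
`f ℓ (ℓ+n) ∘ f (ℓ+n) ℓ` on `W (ℓ+n)` and as `0` on `W j`, `j < n` (`r = π^n` on the `π`-adic tower,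
`r = p^n` on the `p`-adic one): `x n = 0` ⇒ `x j = H¹(r•) (h j)` for a compatible `h`, `H¹(r•)` being the tree's
`galoisCohomology.scalarMapH1` (`= r • ·` for `galoisCohomology.moduleH1`, `smul_def`).
[cite: Howard2004HeegnerKolyvagin, §1.6 and Lemma 3.2.7 (arXiv p. 12, p. 16)] [cite: SerreGaloisCohomology1997, Ch. I §2.2] -/
theorem exists_forall_scalarMapH1_eq_of_apply_eq_zero {R : Type*} [Ring R] [∀ j, Module R (W j)]
    [∀ j, Finite (galoisCohomology (ρ j) 1)] (hρ : ∀ j, (ρ j).IsScalarLinear R)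
    (hid : ∀ a (w : W a), f a a w = w)
    (hcomp : ∀ a b c, c ≤ b → b ≤ a → ∀ w : W a, f b c (f a b w) = f a c w)
    (hsq : ∀ a b, a ≤ b → ∀ w : W (a + 1), f a b (f (a + 1) a w) = f (b + 1) b (f (a + 1) (b + 1) w))
    (hinj : ∀ ℓ n, Function.Injective (f ℓ (ℓ + n)))
    (hsurj : ∀ ℓ n, Function.Surjective (f (ℓ + n) n))
    (hex : ∀ ℓ n (y : W (ℓ + n)), f (ℓ + n) n y = 0 ↔ ∃ x, f ℓ (ℓ + n) x = y)
    (n : ℕ) (r : R) (hr : ∀ ℓ (w : W (ℓ + n)), r • w = f ℓ (ℓ + n) (f (ℓ + n) ℓ w))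
    (hr0 : ∀ j, j < n → ∀ w : W j, r • w = 0)
    {x : Π j, galoisCohomology (ρ j) 1}
    (hx : x ∈ compatibleFamilies (H := fun j ↦ galoisCohomology (ρ j) 1)
      (fun j ↦ galoisCohomology.map (f (j + 1) j) 1))
    (hxn : x n = 0) :
    ∃ h ∈ compatibleFamilies (H := fun j ↦ galoisCohomology (ρ j) 1)
        (fun j ↦ galoisCohomology.map (f (j + 1) j) 1),
      ∀ j, galoisCohomology.scalarMapH1 (ρ j) (hρ j) r (h j) = x j :=
  exists_forall_map_endo_eq_of_apply_eq_zero ρ f hid hcomp hsq hinj hsurj hex n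
    (fun j ↦ DiscreteGaloisModule.scalarIntertwining (ρ j) (hρ j) r)
    (fun ℓ w ↦ by rw [DiscreteGaloisModule.scalarIntertwining_apply]; exact hr ℓ w)
    (fun j hj w ↦ by rw [DiscreteGaloisModule.scalarIntertwining_apply]; exact hr0 j hj w) hx hxn

/-! ## §3 (L) Liftability -/

/-- **(L) LIFTABILITY.** If `H¹(f i (i+d)) y` (`×π^d`) is the `(i+d)`-component of a compatible family `x`
then `y` is the `i`-component of a compatible family — VERBATIM the hypothesis `hL` of
`Tower.comap_levelCondition_eq_of_liftable[_smul]` with `mul := H¹(f i (i+d))`.  Proof (D1's memo (L)):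
for `j ≥ i` compare `0 → W j → W (j+d) → W d → 0` with `0 → W i → W (i+d) → W d → 0` along the reductions
(identity on `W d`): `x (j+d) ↦ x d = H¹(W (i+d) → W d)(H¹(×π^d) y) = 0`, so `x (j+d) = H¹(×π^d) w`;
`H¹(×π^d)(red w - y) = 0`, so `red w - y = δ₀ c = red (δ₀ c)` by NATURALITY of `δ₀`; hence `y` lifts to
`H¹(W j)` for every `j`, and Kőnig (constraint form) gives a compatible lift.
[cite: Howard2004HeegnerKolyvagin, H.3 and §1.6 (arXiv p. 7 L65–67, p. 12, p. 16 L1–3)]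
[cite: SerreGaloisCohomology1997, Ch. I §2.2] [cite: NeukirchSchmidtWingberg2008, (1.3.3) and Cor. 2.7.6] -/
theorem exists_mem_compatibleFamilies_apply_eq_of_map_eq [∀ j, Finite (galoisCohomology (ρ j) 1)]
    (hid : ∀ a (w : W a), f a a w = w)
    (hcomp : ∀ a b c, c ≤ b → b ≤ a → ∀ w : W a, f b c (f a b w) = f a c w)
    (hsq : ∀ a b, a ≤ b → ∀ w : W (a + 1), f a b (f (a + 1) a w) = f (b + 1) b (f (a + 1) (b + 1) w))
    (hinj : ∀ ℓ n, Function.Injective (f ℓ (ℓ + n)))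
    (hsurj : ∀ ℓ n, Function.Surjective (f (ℓ + n) n))
    (hex : ∀ ℓ n (y : W (ℓ + n)), f (ℓ + n) n y = 0 ↔ ∃ x, f ℓ (ℓ + n) x = y)
    (i d : ℕ) (y : galoisCohomology (ρ i) 1)
    (hy : ∃ x ∈ compatibleFamilies (H := fun j ↦ galoisCohomology (ρ j) 1)
        (fun j ↦ galoisCohomology.map (f (j + 1) j) 1),
      galoisCohomology.map (f i (i + d)) 1 y = x (i + d)) :
    ∃ z ∈ compatibleFamilies (H := fun j ↦ galoisCohomology (ρ j) 1)
        (fun j ↦ galoisCohomology.map (f (j + 1) j) 1), z i = y := by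
  obtain ⟨x, hx, hxy⟩ := hy
  have hne : ∀ j, i ≤ j →
      ({Y : galoisCohomology (ρ j) 1 | i ≤ j → galoisCohomology.map (f j i) 1 Y = y}).Nonempty := by
    intro j hij
    -- nonempty at level `j ≥ i`: the long exact sequences and naturality of `δ₀`
    let Sj := isSES_of_exact ρ f hinj hsurj hex j d
    let Si := isSES_of_exact ρ f hinj hsurj hex i d
    -- `x (j+d)` dies in `H¹(W d)`
    have hxd : galoisCohomology.map (f (j + d) d) 1 (x (j + d)) = 0 := by
      rw [map_apply_eq_of_mem ρ f hid hcomp hx (Nat.le_add_left d j),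
        ← map_apply_eq_of_mem ρ f hid hcomp hx (Nat.le_add_left d i), ← hxy]
      exact map_map_eq_zero_of_exact ρ f hex i d y
    obtain ⟨w, hw⟩ : ∃ w : galoisCohomology (ρ j) 1, galoisCohomology.map (f j (j + d)) 1 w = x (j + d) := by
      obtain ⟨w, hw⟩ := Sj.exists_map_one_eq_of_map_one_eq_zero (x (j + d))
        (by rw [← galoisCohomology.map_eq_cohomologyMap_apply]; exact hxd)
      exact ⟨w, by rw [galoisCohomology.map_eq_cohomologyMap_apply]; exact hw⟩
    -- `u := red w - y` is killed by `×π^d`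
    have hu : galoisCohomology.map (f i (i + d)) 1 (galoisCohomology.map (f j i) 1 w - y) = 0 := by
      rw [map_sub, hxy, ← map_apply_eq_of_mem ρ f hid hcomp hx (Nat.add_le_add_right hij d), ← hw,
        galoisCohomology.map_map_of_comp_apply (f j i) (f i (i + d)) ((f (j + d) (i + d)).comp (f j (j + d)))
          (fun v ↦ apply_up_down_comm ρ f hid hcomp hsq hij d v),
        ← galoisCohomology.map_map_of_comp_apply (f j (j + d)) (f (j + d) (i + d))
          ((f (j + d) (i + d)).comp (f j (j + d))) (fun _ ↦ rfl), sub_self]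
    obtain ⟨c, hc⟩ := Si.exists_δ₀_eq_of_map_one_eq_zero (galoisCohomology.map (f j i) 1 w - y)
      (by rw [← galoisCohomology.map_eq_cohomologyMap_apply]; exact hu)
    -- naturality of `δ₀` along `(f j i, f (j+d) (i+d), id)`
    have hnat := IsSES.cohomologyMap_δ₀ (h := Sj) (h' := Si)
      (φ₁ := TopRep.ofHom ⟨(f j i).toContinuousLinearMap, (f j i).isIntertwining'⟩)
      (φ₂ := TopRep.ofHom ⟨(f (j + d) (i + d)).toContinuousLinearMap, (f (j + d) (i + d)).isIntertwining'⟩)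
      (φ₃ := 𝟙 _) (fun v ↦ apply_up_down_comm ρ f hid hcomp hsq hij d v)
      (fun v ↦ (hcomp _ _ _ (Nat.le_add_left d i) (Nat.add_le_add_right hij d) v).symm) c
    have hc' : Si.δ₀ ⟨(𝟙 (ρ d).toTopRep : (ρ d).toTopRep ⟶ (ρ d).toTopRep).hom (c : W d),
        IsSES.mem_invariants_map (g := TopRep.ofHom ⟨(f (j + d) d).toContinuousLinearMap,
          (f (j + d) d).isIntertwining'⟩) (φ₂ := TopRep.ofHom ⟨(f (j + d) (i + d)).toContinuousLinearMap,
          (f (j + d) (i + d)).isIntertwining'⟩)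
          (fun v ↦ (hcomp _ _ _ (Nat.le_add_left d i) (Nat.add_le_add_right hij d) v).symm) c⟩ = Si.δ₀ c :=
      congrArg Si.δ₀ (Subtype.ext rfl)
    rw [hc', hc] at hnat
    set δc : galoisCohomology (ρ j) 1 := Sj.δ₀ c with hδc
    have hnat' : galoisCohomology.map (f j i) 1 δc = galoisCohomology.map (f j i) 1 w - y := by
      rw [hδc, galoisCohomology.map_eq_cohomologyMap_apply]; exact hnat
    -- `y = red (w - δ₀ c)`
    refine ⟨w - δc, fun _ ↦ ?_⟩
    rw [map_sub, hnat', sub_sub_cancel]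
  have hst : ∀ j, i ≤ j →
      ∀ Y ∈ {Y : galoisCohomology (ρ (j + 1)) 1 | i ≤ j + 1 → galoisCohomology.map (f (j + 1) i) 1 Y = y},
        galoisCohomology.map (f (j + 1) j) 1 Y ∈
          {Y : galoisCohomology (ρ j) 1 | i ≤ j → galoisCohomology.map (f j i) 1 Y = y} := by
    intro j hij Y hY _
    -- reduction-stable
    rw [galoisCohomology.map_map_of_comp_apply (f (j + 1) j) (f j i) (f (j + 1) i)
      (fun v ↦ (hcomp _ _ _ hij (Nat.le_succ j) v).symm)]
    exact hY (hij.trans (Nat.le_succ j))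
  obtain ⟨z, hz, hzS⟩ := exists_mem_compatibleFamilies_of_forall_mem_of_le
    (H := fun j ↦ galoisCohomology (ρ j) 1) (fun j ↦ galoisCohomology.map (f (j + 1) j) 1) i
    (fun j ↦ {Y | i ≤ j → galoisCohomology.map (f j i) 1 Y = y}) hne hst
  exact ⟨z, hz, (map_apply_eq_self_of_forall_apply_eq (f i i) (hid i) (z i)).symm.trans
    (hzS i le_rfl le_rfl)⟩

/-! ## §4 (M) and (T) -/

/-- **(M)**: if `f i (i+d) ∘ f (i+d) i = s` on `W (i+d)` (reduce then `×π^d` is multiplication by `π^d`),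
then `H¹(f i (i+d)) ∘ redIter = H¹(s)` on `H¹(F, W (i+d))` — the hypothesis `hM` of
`Tower.comap_levelCondition_eq_of_liftable[_smul]`. [cite: Howard2004HeegnerKolyvagin, Def. 1.1.3 and H.3 (arXiv p. 5, p. 7)] -/
theorem map_redIter_eq_map_endo (hid : ∀ a (w : W a), f a a w = w)
    (hcomp : ∀ a b c, c ≤ b → b ≤ a → ∀ w : W a, f b c (f a b w) = f a c w) (i d : ℕ)
    (s : (ρ (i + d)).toContRepresentation →ⁱL (ρ (i + d)).toContRepresentation)
    (hs : ∀ w : W (i + d), s w = f i (i + d) (f (i + d) i w)) (y : galoisCohomology (ρ (i + d)) 1) :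
    galoisCohomology.map (f i (i + d)) 1
        (redIter (H := fun j ↦ galoisCohomology (ρ j) 1) (fun j ↦ galoisCohomology.map (f (j + 1) j) 1)
          i d y) =
      galoisCohomology.map s 1 y := by
  rw [redIter_eq_map ρ f hid hcomp, galoisCohomology.map_map_of_comp_apply _ _ s hs]

/-- **(M), scalar form**: `H¹(f i (i+d)) (redIter y) = H¹(r•) y` when `r • w = f i (i+d) (f (i+d) i w)`.
[cite: Howard2004HeegnerKolyvagin, Def. 1.1.3 and H.3 (arXiv p. 5, p. 7)] -/
theorem map_redIter_eq_scalarMapH1 {R : Type*} [Ring R] [∀ j, Module R (W j)]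
    (hρ : ∀ j, (ρ j).IsScalarLinear R) (hid : ∀ a (w : W a), f a a w = w)
    (hcomp : ∀ a b c, c ≤ b → b ≤ a → ∀ w : W a, f b c (f a b w) = f a c w) (i d : ℕ) (r : R)
    (hr : ∀ w : W (i + d), r • w = f i (i + d) (f (i + d) i w)) (y : galoisCohomology (ρ (i + d)) 1) :
    galoisCohomology.map (f i (i + d)) 1
        (redIter (H := fun j ↦ galoisCohomology (ρ j) 1) (fun j ↦ galoisCohomology.map (f (j + 1) j) 1)
          i d y) =
      galoisCohomology.scalarMapH1 (ρ (i + d)) (hρ (i + d)) r y :=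
  map_redIter_eq_map_endo ρ f hid hcomp i d (DiscreteGaloisModule.scalarIntertwining _ (hρ (i + d)) r)
    (fun w ↦ by rw [DiscreteGaloisModule.scalarIntertwining_apply]; exact hr w) y

/-- **(T)**: a scalar killing the level kills its `H¹` (`H¹(r•) = 0` if `r • W j = 0`) — the hypothesis `hT`.
[cite: SerreGaloisCohomology1997, Ch. I §2.2] -/
theorem scalarMapH1_eq_zero_of_forall {M : Type u} [AddCommGroup M] [TopologicalSpace M]
    [DiscreteTopology M] {R : Type*} [Ring R] [Module R M] (τ : DiscreteGaloisModule F M)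
    (hτ : τ.IsScalarLinear R) (r : R) (hr : ∀ w : M, r • w = 0) (c : galoisCohomology τ 1) :
    galoisCohomology.scalarMapH1 τ hτ r c = 0 :=
  galoisCohomology.map_eq_zero_of_apply_eq_zero _
    (fun w ↦ by rw [DiscreteGaloisModule.scalarIntertwining_apply]; exact hr w) c

end Tower

end Literature.NumberTheory.EllipticCurves

end
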